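import Summits.QuantumFields.YangMills.Theorems.FlatTubeReductionDiagonalMomentPointwise
import Summits.QuantumFields.YangMills.Theorems.FlatTubeReductionCoreAmplitudes
import HarnessLib

/-!
# The exact diagonal dressing from LEVEL BOUNDS: if on a core `S` the exponent pieces are bounded by polynomials in the Gaussian levels, `|X₁| ≤ a₁Λ`, `|X − X₁| ≤ a₂Λ + a_qQ`
# (`Λ = 1 + N + N_v + N_v'`, `Q = (1 + N_v + N_v')²`), and the reference density has `∫_S ρ₁Λ⁴ ≤ Ξ∫ρ₁`, then
# `(1 − (a₂+a_q)Ξ − η)·f(1) ≤ f(u) ≤ (1 + (a₂+a_q)Ξ + e(a₁+a₂+a_q)²Ξ + η)·f(1)`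
# (route `FlatTubeReduction`, crux K1 `NearFlatRatioLaw` stmt-QuantumFields-24720; seat `ym-line-ftr-p1` g13; rate twin «ratepack-v3 / frozen fibres»; R2b1 RECORD rung — no summit
# statement is proved here)

WHY (memo `Cruxes/NearFlatRatioLaw/Lines/ratepack-v3-frozen-g12.md` §6).  This is the κ_W assembly step (g′) of the blueprint in abstract form: the core+tail sandwich
`…DiagonalMomentSandwichCore.fpBOKernel_diag_two_sided_moment_core` fed with (i) the pointwise level bounds of `…CoreLevelWeights` (`a₁ ∝ τ_u`, `a₂ ∝ τ_u² + σ + √σ`,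
`a_q ∝ (σ + τ_u)β^{-1/2}` — hypotheses `hE1`, `hE2` here), (ii) ONE moment number `Ξ` of the weight `Λ⁴` on the core (from `…ReferenceMoments.reference_moment_le` with the re-weighted
profile — hypothesis `hΞ`), (iii) the two tail masses (g12's `reference_tail_le`/`reference_fibre_tail_le`/`slow_reference_tail_abs_le` — hypotheses `htail1`, `htailu`).  Output:
★★★ `fpBOKernel_diag_two_sided_of_levelBounds` — `|f(u)/f(1) − 1| ≤ (a₂ + a_q)Ξ + e(a₁ + a₂ + a_q)²Ξ + η`: quadratic in the slow amplitude up to `a_q` (AM–GM: `τ_uβ^{-1/2} ≤ ½(τ_u²β^{-1/4} + β^{-3/4})`)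
and the `u`-independent tail `η` — the shape `κ_W·d² + ε_W(β)`, `ε_W ≪ λ_b²`, that the clamp of §6 turns into the `hWsq` field.
HONEST FRAMING: assembly bookkeeping; the moment number, the tails and the integrability of the Haar moments are hypotheses; femto rung R2b1 (RECORD label); not infinite volume, not a
gap, not Clay.  No defs, no named facts, no `sorry`.
-/

set_option autoImplicit false

noncomputable section

open MeasureTheory Filter Topology Real Set
open scoped BigOperators
open Literature.MathematicalPhysics.QuantumFieldTheory
open Literature.MathematicalPhysics.QuantumLattice

namespace Summit.QuantumFields.YangMills.Theorems.FemtoTransferGap.RateTube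

open Summit.QuantumFields.YangMills.Theorems.FemtoTransferGap
open Summit.QuantumFields.YangMills.Theorems.FemtoTransferGap.TwoLattice
open Summit.QuantumFields.YangMills.Theorems.FemtoTransferGap.TwoLattice.ConstTube
open Summit.QuantumFields.YangMills.Theorems.FemtoTransferGap.TwoLattice.Avg
open Summit.QuantumFields.YangMills.Theorems.FemtoTransferGap.TwoLattice.Cov
open Summit.QuantumFields.YangMills.Theorems.FemtoTransferGap.TwoLattice.Toron
open Summit.QuantumFields.YangMills.Theorems.FemtoTransferGap.TwoLattice.Stiff (LinkSpace)

variable {L : ℕ} [NeZero L]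

set_option maxHeartbeats 1600000 in
/-- ★★★ **THE EXACT DIAGONAL DRESSING FROM LEVEL BOUNDS.**  Profile `Ω` (measurable, `0 ≤ Ω ≤ CΩ`, colour-blind), FP weight `fpWeight ε`, slow datum `u`, a measurable core `S` of
fibre/gauge data on which `|X₁(d,p)| ≤ a₁Λ(p)` and `|X(d,p) − X₁(d,p)| ≤ a₂Λ(p) + a_qQ(p)` for all colour rotations `d`, with `a₁Λ + a₂Λ + a_qQ ≤ 1` on `S`
(`Λ = 1 + β·kin + β‖v̂‖² + β‖v̂'‖²`, `Q = (1 + β‖v̂‖² + β‖v̂'‖²)²`); the moment number `∫_S ρ₁Λ⁴ ≤ Ξ∫ρ₁`; the tails `∫_{Sᶜ}ρ₁ ≤ η∫ρ₁`, `∫_{Sᶜ}ρ_{dud⁻¹}/K(u,u) ≤ η·f(1)`.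
Then `(1 − (a₂+a_q)Ξ − η)·f(1) ≤ f(u) ≤ (1 + (a₂+a_q)Ξ + e·(a₁+a₂+a_q)²·Ξ + η)·f(1)`, `f(u) = fpBOKernel β Ω (fpWeight ε) u u / K₁(u,u)`. [cite: Luscher1983, §3] -/
theorem fpBOKernel_diag_two_sided_of_levelBounds {β : ℝ} {Ω : LinkSpace L → ℝ} (hΩm : Measurable Ω) {CΩ : ℝ} (hCΩ : ∀ x, |Ω x| ≤ CΩ) (hΩ0 : ∀ x, 0 ≤ Ω x)
    (hΩinv : ∀ (g : SU2) (x : LinkSpace L), Ω (adL L g x) = Ω x) (ε : ℝ) (u : GaugeConfig 3 1 SU2)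
    {S : Set ((Edge 3 L → Fin 3 → ℝ) × ((Edge 3 L → Fin 3 → ℝ) × (Site 3 L → SU2)))} (hS : MeasurableSet S) {a₁ a₂ aq : ℝ} (ha₁ : 0 ≤ a₁) (ha₂ : 0 ≤ a₂) (haq : 0 ≤ aq)
    (hE1 : ∀ p ∈ S, ∀ d : SU2, |diagX1 L β (slowLin (gaugeTransform (fun _ : Site 3 1 => d) u)) p.1 p.2.1 p.2.2| ≤
      a₁ * (1 + β * kinDefect L (orthoTube L 1 p.1) (orthoTube L 1 p.2.1) p.2.2 + β * ‖linkEmbed L p.1‖ ^ 2 + β * ‖linkEmbed L p.2.1‖ ^ 2))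
    (hE2 : ∀ p ∈ S, ∀ d : SU2, |diagX L β (gaugeTransform (fun _ : Site 3 1 => d) u) p.1 p.2.1 p.2.2 - diagX1 L β (slowLin (gaugeTransform (fun _ : Site 3 1 => d) u)) p.1 p.2.1 p.2.2| ≤
      a₂ * (1 + β * kinDefect L (orthoTube L 1 p.1) (orthoTube L 1 p.2.1) p.2.2 + β * ‖linkEmbed L p.1‖ ^ 2 + β * ‖linkEmbed L p.2.1‖ ^ 2) +
        aq * (1 + β * ‖linkEmbed L p.1‖ ^ 2 + β * ‖linkEmbed L p.2.1‖ ^ 2) ^ 2)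
    (hB : ∀ p ∈ S, a₁ * (1 + β * kinDefect L (orthoTube L 1 p.1) (orthoTube L 1 p.2.1) p.2.2 + β * ‖linkEmbed L p.1‖ ^ 2 + β * ‖linkEmbed L p.2.1‖ ^ 2) +
      (a₂ * (1 + β * kinDefect L (orthoTube L 1 p.1) (orthoTube L 1 p.2.1) p.2.2 + β * ‖linkEmbed L p.1‖ ^ 2 + β * ‖linkEmbed L p.2.1‖ ^ 2) +
        aq * (1 + β * ‖linkEmbed L p.1‖ ^ 2 + β * ‖linkEmbed L p.2.1‖ ^ 2) ^ 2) ≤ 1)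
    (hβ : 0 ≤ β)
    (hM₂i : IntegrableOn (fun p : (Edge 3 L → Fin 3 → ℝ) × ((Edge 3 L → Fin 3 → ℝ) × (Site 3 L → SU2)) => fpTriple L β Ω (fpWeight L ε) 1 1 p *
      ∫ d, |diagX L β (gaugeTransform (fun _ : Site 3 1 => d) u) p.1 p.2.1 p.2.2 - diagX1 L β (slowLin (gaugeTransform (fun _ : Site 3 1 => d) u)) p.1 p.2.1 p.2.2| ∂haarProbability SU2)
      S ((orthoTransverse L).prod ((orthoTransverse L).prod (gaugeMeasure L))))
    (hMRi : IntegrableOn (fun p : (Edge 3 L → Fin 3 → ℝ) × ((Edge 3 L → Fin 3 → ℝ) × (Site 3 L → SU2)) => fpTriple L β Ω (fpWeight L ε) 1 1 p *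
      ∫ d, diagX L β (gaugeTransform (fun _ : Site 3 1 => d) u) p.1 p.2.1 p.2.2 ^ 2 * Real.exp |diagX L β (gaugeTransform (fun _ : Site 3 1 => d) u) p.1 p.2.1 p.2.2| ∂haarProbability SU2)
      S ((orthoTransverse L).prod ((orthoTransverse L).prod (gaugeMeasure L))))
    (hΛi : IntegrableOn (fun p : (Edge 3 L → Fin 3 → ℝ) × ((Edge 3 L → Fin 3 → ℝ) × (Site 3 L → SU2)) => fpTriple L β Ω (fpWeight L ε) 1 1 p *
      (1 + β * kinDefect L (orthoTube L 1 p.1) (orthoTube L 1 p.2.1) p.2.2 + β * ‖linkEmbed L p.1‖ ^ 2 + β * ‖linkEmbed L p.2.1‖ ^ 2) ^ 4)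
      S ((orthoTransverse L).prod ((orthoTransverse L).prod (gaugeMeasure L))))
    {Ξ η : ℝ}
    (hΞ : ∫ p in S, fpTriple L β Ω (fpWeight L ε) 1 1 p *
        (1 + β * kinDefect L (orthoTube L 1 p.1) (orthoTube L 1 p.2.1) p.2.2 + β * ‖linkEmbed L p.1‖ ^ 2 + β * ‖linkEmbed L p.2.1‖ ^ 2) ^ 4
        ∂((orthoTransverse L).prod ((orthoTransverse L).prod (gaugeMeasure L))) ≤
      Ξ * ∫ p, fpTriple L β Ω (fpWeight L ε) 1 1 p ∂((orthoTransverse L).prod ((orthoTransverse L).prod (gaugeMeasure L))))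
    (htail1 : ∫ p in Sᶜ, fpTriple L β Ω (fpWeight L ε) 1 1 p ∂((orthoTransverse L).prod ((orthoTransverse L).prod (gaugeMeasure L))) ≤
      η * ∫ p, fpTriple L β Ω (fpWeight L ε) 1 1 p ∂((orthoTransverse L).prod ((orthoTransverse L).prod (gaugeMeasure L))))
    (htailu : ∀ d : SU2, (∫ p in Sᶜ, fpTriple L β Ω (fpWeight L ε) (gaugeTransform (fun _ : Site 3 1 => d) u) (gaugeTransform (fun _ : Site 3 1 => d) u) p
        ∂((orthoTransverse L).prod ((orthoTransverse L).prod (gaugeMeasure L)))) / transferKernel su2Rep ((L : ℝ) ^ 3 * β) u u ≤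
      η * ((∫ p, fpTriple L β Ω (fpWeight L ε) 1 1 p ∂((orthoTransverse L).prod ((orthoTransverse L).prod (gaugeMeasure L)))) /
        transferKernel su2Rep ((L : ℝ) ^ 3 * β) (1 : GaugeConfig 3 1 SU2) 1)) :
    (1 - (a₂ + aq) * Ξ - η) * (fpBOKernel L β Ω (fpWeight L ε) 1 1 / transferKernel su2Rep ((L : ℝ) ^ 3 * β) (1 : GaugeConfig 3 1 SU2) 1) ≤
        fpBOKernel L β Ω (fpWeight L ε) u u / transferKernel su2Rep ((L : ℝ) ^ 3 * β) u u ∧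
      fpBOKernel L β Ω (fpWeight L ε) u u / transferKernel su2Rep ((L : ℝ) ^ 3 * β) u u ≤
        (1 + (a₂ + aq) * Ξ + Real.exp 1 * (a₁ + a₂ + aq) ^ 2 * Ξ + η) * (fpBOKernel L β Ω (fpWeight L ε) 1 1 / transferKernel su2Rep ((L : ℝ) ^ 3 * β) (1 : GaugeConfig 3 1 SU2) 1) := by
  haveI := isFiniteMeasure_orthoTransverse L
  haveI : SecondCountableTopology SU2 := secondCountableTopology_su2
  set μP : Measure ((Edge 3 L → Fin 3 → ℝ) × ((Edge 3 L → Fin 3 → ℝ) × (Site 3 L → SU2))) := (orthoTransverse L).prod ((orthoTransverse L).prod (gaugeMeasure L)) with hμP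
  -- abbreviations
  set ρ : ((Edge 3 L → Fin 3 → ℝ) × ((Edge 3 L → Fin 3 → ℝ) × (Site 3 L → SU2))) → ℝ := fun p => fpTriple L β Ω (fpWeight L ε) 1 1 p with hρ
  set Λ : ((Edge 3 L → Fin 3 → ℝ) × ((Edge 3 L → Fin 3 → ℝ) × (Site 3 L → SU2))) → ℝ := fun p =>
    1 + β * kinDefect L (orthoTube L 1 p.1) (orthoTube L 1 p.2.1) p.2.2 + β * ‖linkEmbed L p.1‖ ^ 2 + β * ‖linkEmbed L p.2.1‖ ^ 2 with hΛ
  set Q : ((Edge 3 L → Fin 3 → ℝ) × ((Edge 3 L → Fin 3 → ℝ) × (Site 3 L → SU2))) → ℝ := fun p => (1 + β * ‖linkEmbed L p.1‖ ^ 2 + β * ‖linkEmbed L p.2.1‖ ^ 2) ^ 2 with hQ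
  set M₂ : ((Edge 3 L → Fin 3 → ℝ) × ((Edge 3 L → Fin 3 → ℝ) × (Site 3 L → SU2))) → ℝ := fun p =>
    ∫ d, |diagX L β (gaugeTransform (fun _ : Site 3 1 => d) u) p.1 p.2.1 p.2.2 - diagX1 L β (slowLin (gaugeTransform (fun _ : Site 3 1 => d) u)) p.1 p.2.1 p.2.2| ∂haarProbability SU2
    with hM₂
  set MR : ((Edge 3 L → Fin 3 → ℝ) × ((Edge 3 L → Fin 3 → ℝ) × (Site 3 L → SU2))) → ℝ := fun p =>
    ∫ d, diagX L β (gaugeTransform (fun _ : Site 3 1 => d) u) p.1 p.2.1 p.2.2 ^ 2 * Real.exp |diagX L β (gaugeTransform (fun _ : Site 3 1 => d) u) p.1 p.2.1 p.2.2| ∂haarProbability SU2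
    with hMR
  have hρ0 : ∀ p, 0 ≤ ρ p := fun p => by
    rw [hρ]; dsimp only; unfold fpTriple
    exact mul_nonneg (hΩ0 _) (mul_nonneg (mul_nonneg (fpWeight_mem_Icc L ε _).1 (transferKernel_pos _ _ _ _).le) (hΩ0 _))
  have hΛ1 : ∀ p, 1 ≤ Λ p := fun p => by
    rw [hΛ]; dsimp only
    have := kinDefect_nonneg (L := L) (orthoTube L 1 p.1) (orthoTube L 1 p.2.1) p.2.2
    nlinarith [sq_nonneg ‖linkEmbed L p.1‖, sq_nonneg ‖linkEmbed L p.2.1‖, mul_nonneg hβ this, mul_nonneg hβ (sq_nonneg ‖linkEmbed L p.1‖),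
      mul_nonneg hβ (sq_nonneg ‖linkEmbed L p.2.1‖)]
  have hQΛ : ∀ p, Q p ≤ Λ p ^ 2 := fun p => by
    rw [hQ, hΛ]; dsimp only
    have hk := mul_nonneg hβ (kinDefect_nonneg (L := L) (orthoTube L 1 p.1) (orthoTube L 1 p.2.1) p.2.2)
    have h0 : 0 ≤ 1 + β * ‖linkEmbed L p.1‖ ^ 2 + β * ‖linkEmbed L p.2.1‖ ^ 2 := by
      nlinarith [mul_nonneg hβ (sq_nonneg ‖linkEmbed L p.1‖), mul_nonneg hβ (sq_nonneg ‖linkEmbed L p.2.1‖)]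
    exact pow_le_pow_left₀ h0 (by linarith) 2
  have hQ0 : ∀ p, 0 ≤ Q p := fun p => by rw [hQ]; positivity
  -- pointwise: M₂ ≤ (a₂ + aq)Λ⁴, MR ≤ e(a₁+a₂+aq)²Λ⁴ on S
  have hpow : ∀ p, Λ p ≤ Λ p ^ 4 ∧ Λ p ^ 2 ≤ Λ p ^ 4 := fun p => by
    have h1 := hΛ1 p
    refine ⟨?_, ?_⟩ <;> nlinarith [pow_le_pow_right₀ h1 (by norm_num : 1 ≤ 4), pow_le_pow_right₀ h1 (by norm_num : 2 ≤ 4)]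
  have hM₂pt : ∀ p ∈ S, M₂ p ≤ (a₂ + aq) * Λ p ^ 4 := fun p hp => by
    have h := haarMoment2_le (L := L) β u p.1 p.2.1 p.2.2 (hE2 p hp)
    rw [hM₂]
    refine h.trans ?_
    obtain ⟨h1, h2⟩ := hpow p
    nlinarith [mul_le_mul_of_nonneg_left h1 ha₂, mul_le_mul_of_nonneg_left ((hQΛ p).trans h2) haq]
  have hMRpt : ∀ p ∈ S, MR p ≤ Real.exp 1 * (a₁ + a₂ + aq) ^ 2 * Λ p ^ 4 := fun p hp => by
    have h := haarMomentR_le (L := L) β u p.1 p.2.1 p.2.2 (hE1 p hp) (hE2 p hp)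
    rw [hMR]
    refine h.trans ?_
    have hsum1 : a₁ * Λ p + (a₂ * Λ p + aq * Q p) ≤ 1 := hB p hp
    have hsum0 : 0 ≤ a₁ * Λ p + (a₂ * Λ p + aq * Q p) := by
      have := hΛ1 p; have := hQ0 p; positivity
    have hexp : Real.exp (a₁ * Λ p + (a₂ * Λ p + aq * Q p)) ≤ Real.exp 1 := Real.exp_le_exp.mpr hsum1
    have hsq : (a₁ * Λ p + (a₂ * Λ p + aq * Q p)) ^ 2 ≤ (a₁ + a₂ + aq) ^ 2 * Λ p ^ 4 := by
      have hle : a₁ * Λ p + (a₂ * Λ p + aq * Q p) ≤ (a₁ + a₂ + aq) * Λ p ^ 2 := by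
        have h1 : Λ p ≤ Λ p ^ 2 := by nlinarith [hΛ1 p]
        nlinarith [mul_le_mul_of_nonneg_left h1 ha₁, mul_le_mul_of_nonneg_left h1 ha₂, mul_le_mul_of_nonneg_left (hQΛ p) haq]
      calc (a₁ * Λ p + (a₂ * Λ p + aq * Q p)) ^ 2 ≤ ((a₁ + a₂ + aq) * Λ p ^ 2) ^ 2 := pow_le_pow_left₀ hsum0 hle 2
        _ = (a₁ + a₂ + aq) ^ 2 * Λ p ^ 4 := by ring
    calc (a₁ * Λ p + (a₂ * Λ p + aq * Q p)) ^ 2 * Real.exp (a₁ * Λ p + (a₂ * Λ p + aq * Q p)) ≤ ((a₁ + a₂ + aq) ^ 2 * Λ p ^ 4) * Real.exp 1 :=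
          mul_le_mul hsq hexp (Real.exp_pos _).le (by positivity)
      _ = Real.exp 1 * (a₁ + a₂ + aq) ^ 2 * Λ p ^ 4 := by ring
  -- the core moments
  have hM₂ : ∫ p in S, ρ p * M₂ p ∂μP ≤ ((a₂ + aq) * Ξ) * ∫ p, ρ p ∂μP := by
    have h1 : ∫ p in S, ρ p * M₂ p ∂μP ≤ ∫ p in S, (a₂ + aq) * (ρ p * Λ p ^ 4) ∂μP := by
      refine setIntegral_mono_on hM₂i (hΛi.const_mul _) hS fun p hp => ?_
      have := mul_le_mul_of_nonneg_left (hM₂pt p hp) (hρ0 p)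
      nlinarith [this]
    rw [integral_const_mul] at h1
    calc ∫ p in S, ρ p * M₂ p ∂μP ≤ (a₂ + aq) * ∫ p in S, ρ p * Λ p ^ 4 ∂μP := h1
      _ ≤ (a₂ + aq) * (Ξ * ∫ p, ρ p ∂μP) := mul_le_mul_of_nonneg_left hΞ (by positivity)
      _ = ((a₂ + aq) * Ξ) * ∫ p, ρ p ∂μP := by ring
  have hMRm : ∫ p in S, ρ p * MR p ∂μP ≤ (Real.exp 1 * (a₁ + a₂ + aq) ^ 2 * Ξ) * ∫ p, ρ p ∂μP := by
    have h1 : ∫ p in S, ρ p * MR p ∂μP ≤ ∫ p in S, (Real.exp 1 * (a₁ + a₂ + aq) ^ 2) * (ρ p * Λ p ^ 4) ∂μP := by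
      refine setIntegral_mono_on hMRi (hΛi.const_mul _) hS fun p hp => ?_
      have := mul_le_mul_of_nonneg_left (hMRpt p hp) (hρ0 p)
      nlinarith [this]
    rw [integral_const_mul] at h1
    calc ∫ p in S, ρ p * MR p ∂μP ≤ (Real.exp 1 * (a₁ + a₂ + aq) ^ 2) * ∫ p in S, ρ p * Λ p ^ 4 ∂μP := h1
      _ ≤ (Real.exp 1 * (a₁ + a₂ + aq) ^ 2) * (Ξ * ∫ p, ρ p ∂μP) := mul_le_mul_of_nonneg_left hΞ (by positivity)
      _ = (Real.exp 1 * (a₁ + a₂ + aq) ^ 2 * Ξ) * ∫ p, ρ p ∂μP := by ring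
  -- the pointwise bound `B p = 1` on the core
  have hX1b : ∀ p ∈ S, ∀ d : SU2, |diagX1 L β (slowLin (gaugeTransform (fun _ : Site 3 1 => d) u)) p.1 p.2.1 p.2.2| ≤ 1 := fun p hp d => by
    have h := hE1 p hp d
    have := hB p hp
    have : 0 ≤ a₂ * Λ p + aq * Q p := by have := hΛ1 p; have := hQ0 p; positivity
    exact h.trans (by linarith)
  have hXb : ∀ p ∈ S, ∀ d : SU2, |diagX L β (gaugeTransform (fun _ : Site 3 1 => d) u) p.1 p.2.1 p.2.2| ≤ 1 := fun p hp d => by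
    have h := abs_diagX_conj_le_of_bounds (L := L) β u p.1 p.2.1 p.2.2 (hE1 p hp) (hE2 p hp) d
    exact h.trans (hB p hp)
  exact fpBOKernel_diag_two_sided_moment_core (L := L) hΩm hCΩ hΩ0 hΩinv (measurable_fpWeight L ε) (abs_fpWeight_le L ε) (fun g => (fpWeight_mem_Icc L ε g).1)
    (fun c g => fpWeight_conj ε c g) u hS (fun _ => (1 : ℝ)) hXb hX1b hM₂i hMRi hM₂ hMRm htail1 htailu

end Summit.QuantumFields.YangMills.Theorems.FemtoTransferGap.RateTube

end
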